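import Summits.RiemannHypothesis.RiemannHypothesis.Theorems.JensenPolynomialsCapCertRecursion
import Summits.RiemannHypothesis.RiemannHypothesis.Theorems.JensenPolynomialsCapTailCompute

/-!
# Route `JensenPolynomials` — uniform tail of `XiCumulantMajorantCap(Far)`, part T2: the `d`-uniform cap bounds

The uniform tail (all `d ≥ D⋆ = 100` at once; see part T1 `JensenPolynomialsCapTailCompute` for the scheme and the
certificate `tailCheck`) of the crux children `XiCumulantMajorantCap` (stmt-RiemannHypothesis-19217) and
`XiCumulantMajorantCapFar` (stmt-RiemannHypothesis-19472) of route `JensenPolynomials` (rung J-P(P1′), cell rh-jensen,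
engine seat g4).  RH-FREE, γ-FREE: elementary arithmetic on a fixed majorant series — nothing here is a statement about `ξ`
or `ζ`, and nothing here bears on the truth of RH.  Every lemma is stated over VARIABLE data `(q, D, y, bts, T, C, J, …)` and is
instantiated at the certificate's constants only by `exact` in part T4 (no tactic ever unfolds a `2⁹⁶`-scale constant).

This part: `M_d ≥ 2d³`; `(4x)² ≤ 8/d²`; `b̃₃ ≤ ⌈9q/8⌉/ONE` for any upper fixed point `q` of `√(1/2)` (`(dx)² ≤ 1/2`); the exact
identity `b̃_k = (k/12)·d·(4x)^{k−2}` and the uniform bound `b̃_k ≤ (k/12)·D·(y/ONE)^{k−2}` for `k ≥ 4`, `d ≥ D`,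
`√8/D ≤ y/ONE` (decreasing in `d`); the dominating list `btsOf q D y`; the geometric `k`-tail `Σ_{k>KK} b̃_k ≤ TOf D y/ONE`
(comparison `(K+1+l)y^{n+l} ≤ (K+1)y^n y'^l`); and all partial `b̃`-sums `≤ 3` from the check `B + T ≤ 3·ONE`.
-/

-- D-0017: `Summit.RiemannHypothesis.RiemannHypothesis.…` duplicates the namespace BY DESIGN (single-problem summit).
set_option linter.dupNamespace false

open Finset

namespace Summit.RiemannHypothesis.RiemannHypothesis.Theorems.JensenPolynomials.CapCert

noncomputable section

open Real
open Summit.RiemannHypothesis.RiemannHypothesis.Theorems.JensenPolynomials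

/-! ## The `d`-uniform cap bounds (all over variable data) -/

/-- `M_d ≥ 2d³`. -/
theorem two_cube_le_Mof (d : ℕ) : 2 * (d : ℝ) ^ 3 ≤ (Mof d : ℝ) := by
  have : 2 * d ^ 3 ≤ Mof d := by unfold Mof; have := le_max_right 10000 (2 * d ^ 3); omega
  exact_mod_cast this

/-- `(4x)² ≤ 8/d²` for `d ≥ 1`. -/
theorem four_xr_sq_le {d : ℕ} (hd : 1 ≤ d) : (4 * xr d) ^ 2 ≤ 8 / (d : ℝ) ^ 2 := by
  have hM := (Mof_facts d).2
  have hd' : (1 : ℝ) ≤ d := by exact_mod_cast hd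
  have h2 := two_cube_le_Mof d
  rw [mul_pow, (xr_facts d).2, show (4 : ℝ) ^ 2 * ((d : ℝ) / (Mof d : ℝ)) = 16 * (d : ℝ) / (Mof d : ℝ) by ring,
    div_le_div_iff₀ hM (by positivity)]
  nlinarith

/-- `4x ≤ √8/d` for `d ≥ 1`. -/
theorem four_xr_le {d : ℕ} (hd : 1 ≤ d) : 4 * xr d ≤ √8 / (d : ℝ) := by
  have h0 : 0 ≤ 4 * xr d := mul_nonneg (by norm_num) ((xr_facts d).1)
  have hd' : (0 : ℝ) < d := by exact_mod_cast (show 0 < d by omega)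
  rw [← Real.sqrt_sq h0, show √8 / (d : ℝ) = √(8 / (d : ℝ) ^ 2) by
    rw [Real.sqrt_div' _ (by positivity), Real.sqrt_sq hd'.le]]
  exact Real.sqrt_le_sqrt (four_xr_sq_le hd)

/-- `√8/D ≤ ⌈√(8/D²)⌉⁺/ONE` for `D ≥ 1`. -/
theorem sqrt8_div_le (D : ℕ) (hD : 0 < D) : √8 / (D : ℝ) ≤ (sqrtU (ofRatU 8 (D ^ 2)) : ℝ) / ONE := by
  have hDR : (0 : ℝ) < D := by exact_mod_cast hD
  rw [show √8 / (D : ℝ) = √(8 / (D : ℝ) ^ 2) by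
    rw [Real.sqrt_div' _ (by positivity), Real.sqrt_sq hDR.le]]
  apply sqrtU_ge
  have := ofRatU_ge 8 (D ^ 2) (by positivity)
  push_cast at this
  exact this

/-- `√(1/2) ≤ ⌈√(1/2)⌉⁺/ONE`. -/
theorem sqrt_half_le : √(1 / 2) ≤ (sqrtU (ofRatU 1 2) : ℝ) / ONE := by
  apply sqrtU_ge
  have := ofRatU_ge 1 2 (by norm_num)
  push_cast at this
  exact this

/-- **`b̃₃ ≤ ⌈9q/8⌉/ONE` for any upper fixed point `q` of `√(1/2)`** (`(d·x)² = d³/M ≤ 1/2`). -/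
theorem bt_three_le_of (d q : ℕ) (hq : √(1 / 2) ≤ (q : ℝ) / ONE) : bt d 3 ≤ (cdiv (9 * q) 8 : ℝ) / ONE := by
  rw [bt_three]
  have hM := (Mof_facts d).2
  have hx0 := (xr_facts d).1
  have hsq : ((d : ℝ) * xr d) ^ 2 ≤ 1 / 2 := by
    rw [mul_pow, (xr_facts d).2, show (d : ℝ) ^ 2 * ((d : ℝ) / (Mof d : ℝ)) = (d : ℝ) ^ 3 / (Mof d : ℝ) by ring,
      div_le_div_iff₀ hM (by norm_num)]
    nlinarith [two_cube_le_Mof d]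
  have h1 : (d : ℝ) * xr d ≤ (q : ℝ) / ONE := by
    have h0 : 0 ≤ (d : ℝ) * xr d := mul_nonneg (Nat.cast_nonneg _) hx0
    rw [← Real.sqrt_sq h0]
    exact (Real.sqrt_le_sqrt hsq).trans hq
  have hc := div_le_cdiv (9 * q) 8 (by norm_num)
  rw [le_div_iff₀ ONE_facts.1]
  refine le_trans ?_ hc
  push_cast
  rw [le_div_iff₀ (by norm_num : (0:ℝ) < 8)]
  have : (d : ℝ) * xr d * ONE ≤ (q : ℝ) := by rwa [le_div_iff₀ ONE_facts.1] at h1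
  nlinarith

/-- Monotone scaling: `d·(c/d)^{m+1} ≤ D·(c/D)^{m+1}` for `0 < D ≤ d`, `c ≥ 0`. -/
theorem mul_div_pow_succ_le {c D d : ℝ} (hc : 0 ≤ c) (hD : 0 < D) (hDd : D ≤ d) (m : ℕ) :
    d * (c / d) ^ (m + 1) ≤ D * (c / D) ^ (m + 1) := by
  have hd : 0 < d := hD.trans_le hDd
  have e1 : d * (c / d) ^ (m + 1) = c * (c / d) ^ m := by
    rw [pow_succ, div_pow]; field_simp
  have e2 : D * (c / D) ^ (m + 1) = c * (c / D) ^ m := by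
    rw [pow_succ, div_pow]; field_simp
  rw [e1, e2]
  apply mul_le_mul_of_nonneg_left _ hc
  exact pow_le_pow_left₀ (div_nonneg hc hd.le) (div_le_div_of_nonneg_left hc hD hDd) m

/-- **The exact identity `b̃_k = (k/12)·d·(4x)^{k−2}` for `k ≥ 4`.** -/
theorem bt_eq_twelve {d k : ℕ} (hk : 4 ≤ k) :
    bt d k = (k : ℝ) / 12 * (d : ℝ) * (4 * xr d) ^ (k - 2) := by
  rw [bt_eq_y hk]
  have hM := (Mof_facts d).2
  obtain ⟨n, rfl⟩ : ∃ n, k = n + 2 := ⟨k - 2, by omega⟩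
  have h2 : (4 * xr d) ^ 2 = 16 * ((d : ℝ) / (Mof d : ℝ)) := by rw [mul_pow, (xr_facts d).2]; norm_num
  rw [Nat.add_sub_cancel, pow_add, h2]
  field_simp
  ring

/-- **Uniform real bound `b̃_k ≤ (k/12)·D·(y/ONE)^{k−2}` for `k ≥ 4`, `0 < D ≤ d`, `√8/D ≤ y/ONE`.** -/
theorem bt_le_unif {D y d k : ℕ} (hD : 0 < D) (hy : √8 / (D : ℝ) ≤ (y : ℝ) / ONE) (hd : D ≤ d) (hk : 4 ≤ k) :
    bt d k ≤ (k : ℝ) / 12 * (D : ℝ) * ((y : ℝ) / ONE) ^ (k - 2) := by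
  rw [bt_eq_twelve hk]
  have hDR : (0 : ℝ) < D := by exact_mod_cast hD
  have hDd : (D : ℝ) ≤ d := by exact_mod_cast hd
  have hd1 : 1 ≤ d := le_trans hD hd
  have hs0 : 0 ≤ 4 * xr d := mul_nonneg (by norm_num) ((xr_facts d).1)
  have hs := four_xr_le hd1
  have hy0 : 0 ≤ √8 / (D : ℝ) := div_nonneg (Real.sqrt_nonneg _) hDR.le
  obtain ⟨m, hm⟩ : ∃ m, k - 2 = m + 1 := ⟨k - 3, by omega⟩
  rw [hm, mul_assoc, mul_assoc]
  apply mul_le_mul_of_nonneg_left _ (by positivity)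
  calc (d : ℝ) * (4 * xr d) ^ (m + 1) ≤ (d : ℝ) * (√8 / d) ^ (m + 1) :=
        mul_le_mul_of_nonneg_left (pow_le_pow_left₀ hs0 hs _) (Nat.cast_nonneg _)
    _ ≤ (D : ℝ) * (√8 / D) ^ (m + 1) := mul_div_pow_succ_le (Real.sqrt_nonneg _) hDR hDd m
    _ ≤ (D : ℝ) * ((y : ℝ) / ONE) ^ (m + 1) :=
        mul_le_mul_of_nonneg_left (pow_le_pow_left₀ hy0 hy _) hDR.le

/-- `b̃_k ≤ ⌈kDy^{k−2}/12⌉/ONE` (fixed point) for `k ≥ 4`. -/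
theorem bt_le_cdiv {D y d k : ℕ} (hD : 0 < D) (hy : √8 / (D : ℝ) ≤ (y : ℝ) / ONE) (hd : D ≤ d) (hk : 4 ≤ k) :
    bt d k ≤ (cdiv (k * D * powU y (k - 2)) 12 : ℝ) / ONE := by
  refine (bt_le_unif hD hy hd hk).trans ?_
  have hc := div_le_cdiv (k * D * powU y (k - 2)) 12 (by norm_num)
  rw [le_div_iff₀ ONE_facts.1]
  refine le_trans ?_ hc
  push_cast
  rw [le_div_iff₀ (by norm_num : (0:ℝ) < 12)]
  have hp := powU_ge (a := y) (fp_nonneg y) le_rfl (k - 2)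
  have hp' : ((y : ℝ) / ONE) ^ (k - 2) * ONE ≤ (powU y (k - 2) : ℝ) := by
    rwa [le_div_iff₀ ONE_facts.1] at hp
  have hkD : (0 : ℝ) ≤ (k : ℝ) * D := by positivity
  nlinarith

/-- Entries of the uniform memo list. -/
theorem btsOf_getD (q D y : ℕ) {i : ℕ} (hi : 2 ≤ i) (hiK : i < KK) :
    (btsOf q D y).getD (i - 2) 0 =
      (if i = 2 then cdiv (9 * q) 8 else cdiv ((i + 1) * D * powU y (i - 1)) 12) := by
  unfold btsOf
  have h : i - 2 < KK - 2 := by unfold KK at *; omega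
  rw [List.getD_eq_getElem?_getD, List.getElem?_map, List.getElem?_range h, Option.map_some, Option.getD_some]
  by_cases h2 : i = 2
  · subst h2; simp
  · rw [if_neg (by omega), if_neg h2]
    have e1 : i - 2 + 3 = i + 1 := by omega
    have e2 : i - 2 + 1 = i - 1 := by omega
    rw [e1, e2]

/-- **`b̃_{i+1} ≤` list entry `/ONE` for `2 ≤ i < KK`**, for all `d ≥ D`. -/
theorem bt_le_btsOf {q D y d : ℕ} (hq : √(1 / 2) ≤ (q : ℝ) / ONE) (hD : 0 < D)
    (hy : √8 / (D : ℝ) ≤ (y : ℝ) / ONE) (hd : D ≤ d) {i : ℕ} (hi : 2 ≤ i) (hiK : i < KK) :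
    bt d (i + 1) ≤ ((btsOf q D y).getD (i - 2) 0 : ℝ) / ONE := by
  rw [btsOf_getD q D y hi hiK]
  by_cases h2 : i = 2
  · subst h2; rw [if_pos rfl]; exact bt_three_le_of d q hq
  · rw [if_neg h2]
    have h := bt_le_cdiv hD hy hd (by omega : 4 ≤ i + 1)
    have e : i + 1 - 2 = i - 1 := by omega
    rwa [e] at h

/-- Geometric comparison with a general base exponent: `(K+1+l)·y^{n+l} ≤ (K+1)·y^n·y'^l`, `y' = (K+2)y/(K+1)`. -/
theorem kyn_pow_le (K n : ℕ) {y : ℝ} (hy : 0 ≤ y) (l : ℕ) :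
    ((K + 1 + l : ℕ) : ℝ) * y ^ (n + l) ≤ ((K : ℝ) + 1) * y ^ n * ((((K : ℝ) + 2) / ((K : ℝ) + 1)) * y) ^ l := by
  induction l with
  | zero => simp
  | succ l ih =>
    have hK0 : (0 : ℝ) ≤ K := Nat.cast_nonneg _
    have hl0 : (0 : ℝ) ≤ l := Nat.cast_nonneg _
    have hY : 0 ≤ y ^ (n + l) := pow_nonneg hy _
    have hK : (0 : ℝ) < (K : ℝ) + 1 := by positivity
    have step : ((K + 1 + (l + 1) : ℕ) : ℝ) * y ^ (n + (l + 1))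
        ≤ ((((K : ℝ) + 2) / ((K : ℝ) + 1)) * y) * (((K + 1 + l : ℕ) : ℝ) * y ^ (n + l)) := by
      have e : y ^ (n + (l + 1)) = y * y ^ (n + l) := by ring
      rw [e]
      have hc : ((K + 1 + (l + 1) : ℕ) : ℝ) * ((K : ℝ) + 1) ≤ ((K : ℝ) + 2) * ((K + 1 + l : ℕ) : ℝ) := by
        push_cast; nlinarith
      rw [div_mul_eq_mul_div, div_mul_eq_mul_div, le_div_iff₀ hK]
      have hyY : 0 ≤ y * y ^ (n + l) := mul_nonneg hy hY
      calc ((K + 1 + (l + 1) : ℕ) : ℝ) * (y * y ^ (n + l)) * ((K : ℝ) + 1)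
          = (((K + 1 + (l + 1) : ℕ) : ℝ) * ((K : ℝ) + 1)) * (y * y ^ (n + l)) := by ring
        _ ≤ (((K : ℝ) + 2) * ((K + 1 + l : ℕ) : ℝ)) * (y * y ^ (n + l)) :=
            mul_le_mul_of_nonneg_right hc hyY
        _ = ((K : ℝ) + 2) * y * (((K + 1 + l : ℕ) : ℝ) * y ^ (n + l)) := by ring
    refine step.trans ?_
    have hy' : 0 ≤ (((K : ℝ) + 2) / ((K : ℝ) + 1)) * y := by positivity
    calc ((((K : ℝ) + 2) / ((K : ℝ) + 1)) * y) * (((K + 1 + l : ℕ) : ℝ) * y ^ (n + l))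
        ≤ ((((K : ℝ) + 2) / ((K : ℝ) + 1)) * y) *
            (((K : ℝ) + 1) * y ^ n * ((((K : ℝ) + 2) / ((K : ℝ) + 1)) * y) ^ l) :=
          mul_le_mul_of_nonneg_left ih hy'
      _ = ((K : ℝ) + 1) * y ^ n * ((((K : ℝ) + 2) / ((K : ℝ) + 1)) * y) ^ (l + 1) := by ring

/-- Generic geometric `k`-tail: if `a_{i+1} ≤ c·(i+1)·w^{i−1}` for `i ≥ KK` (`0 ≤ w`, `w' = (KK+2)w/(KK+1) < 1`), then
`Σ_{i<n, KK≤i} a_{i+1} ≤ c·(KK+1)·w^{KK−1}·(1/(1−w'))`. -/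
theorem sum_ktail_le (a : ℕ → ℝ) {c w : ℝ} (hc : 0 ≤ c) (hw : 0 ≤ w)
    (hw' : (((KK : ℝ) + 2) / ((KK : ℝ) + 1)) * w < 1)
    (ha : ∀ i, KK ≤ i → a (i + 1) ≤ c * ((i : ℝ) + 1) * w ^ (i - 1)) (n : ℕ) :
    ∑ i ∈ range n, (if KK ≤ i then a (i + 1) else 0)
      ≤ c * (((KK : ℝ) + 1) * w ^ (KK - 1)) * (1 / (1 - (((KK : ℝ) + 2) / ((KK : ℝ) + 1)) * w)) := by
  set w' := (((KK : ℝ) + 2) / ((KK : ℝ) + 1)) * w with hw'_def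
  have hw'0 : 0 ≤ w' := by positivity
  have hK1 : 1 ≤ KK := by decide
  have hterm : ∀ i ∈ range n, (if KK ≤ i then a (i + 1) else 0)
      ≤ (if KK ≤ i then c * (((KK : ℝ) + 1) * w ^ (KK - 1)) * w' ^ (i - KK) else 0) := by
    intro i _
    split_ifs with h
    · refine (ha i h).trans ?_
      have key := kyn_pow_le KK (KK - 1) hw (i - KK)
      have e1 : KK + 1 + (i - KK) = i + 1 := by omega
      have e2 : KK - 1 + (i - KK) = i - 1 := by omega
      rw [e1, e2] at key
      push_cast at key
      have := mul_le_mul_of_nonneg_left key hc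
      calc c * ((i : ℝ) + 1) * w ^ (i - 1) = c * (((i : ℝ) + 1) * w ^ (i - 1)) := by ring
        _ ≤ c * (((KK : ℝ) + 1) * w ^ (KK - 1) * ((((KK : ℝ) + 2) / ((KK : ℝ) + 1)) * w) ^ (i - KK)) := this
        _ = c * (((KK : ℝ) + 1) * w ^ (KK - 1)) * w' ^ (i - KK) := by rw [hw'_def]; ring
    · exact le_rfl
  refine (Finset.sum_le_sum hterm).trans ?_
  have hC : 0 ≤ c * (((KK : ℝ) + 1) * w ^ (KK - 1)) := by positivity
  rcases Nat.lt_or_ge KK n with h | h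
  swap
  · rw [Finset.sum_eq_zero (fun i hi => by rw [Finset.mem_range] at hi; rw [if_neg (by omega)])]
    have : 0 ≤ 1 / (1 - w') := by apply div_nonneg zero_le_one; linarith
    exact mul_nonneg hC this
  · rw [← Finset.sum_range_add_sum_Ico _ h.le,
      Finset.sum_eq_zero (fun i hi => by rw [Finset.mem_range] at hi; rw [if_neg (by omega)]), zero_add,
      Finset.sum_Ico_eq_sum_range]
    have : ∑ k ∈ range (n - KK), (if KK ≤ KK + k then c * (((KK : ℝ) + 1) * w ^ (KK - 1)) * w' ^ (KK + k - KK) else 0)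
        = c * (((KK : ℝ) + 1) * w ^ (KK - 1)) * ∑ k ∈ range (n - KK), w' ^ k := by
      rw [Finset.mul_sum]
      apply Finset.sum_congr rfl
      intro k _
      rw [if_pos (by omega), Nat.add_sub_cancel_left]
    rw [this]
    have hg : ∑ k ∈ range (n - KK), w' ^ k ≤ 1 / (1 - w') := by
      have h := geom_sum_Ico_le_of_lt_one (m := 0) (n := n - KK) hw'0 hw'
      rw [pow_zero, ← Finset.range_eq_Ico] at h
      exact h
    exact mul_le_mul_of_nonneg_left hg hC

/-- The real ratio `(KK+2)/(KK+1)·(y/ONE)` is below its upward fixed point `ypOfT y / ONE`. -/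
theorem ratio_le_ypOfT (y : ℕ) :
    (((KK : ℝ) + 2) / ((KK : ℝ) + 1)) * ((y : ℝ) / ONE) ≤ (ypOfT y : ℝ) / ONE := by
  unfold ypOfT
  have h := div_le_cdiv ((KK + 2) * y) (KK + 1) (by norm_num)
  rw [le_div_iff₀ ONE_facts.1]
  refine le_trans ?_ h
  push_cast
  have hK : (0 : ℝ) < (KK : ℝ) + 1 := by positivity
  rw [le_div_iff₀ hK]
  have hO := ONE_facts.1
  field_simp
  nlinarith

/-- Fixed-point comparison used by both geometric tails: for reals `A ≤ A⁺/ONE`, `B ≤ B⁺/ONE` (`A, B ≥ 0`) and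
`(ONE − p)/ONE ≤ 1 − w'` with `p < ONE`, `w' < 1`: `A·B·(1/(1−w')) ≤ ⌈A⁺B⁺/(ONE−p)⌉/ONE`. -/
theorem fp_tail_compare {A B w' : ℝ} {Ap Bp p : ℕ} (hA0 : 0 ≤ A) (hB0 : 0 ≤ B) (hA : A ≤ (Ap : ℝ) / ONE)
    (hB : B ≤ (Bp : ℝ) / ONE) (hp : p < ONE) (hw1 : w' < 1) (hw : ((ONE - p : ℕ) : ℝ) / ONE ≤ 1 - w') :
    A * B * (1 / (1 - w')) ≤ (cdiv (Ap * Bp) (ONE - p) : ℝ) / ONE := by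
  have hden : 0 < ONE - p := Nat.sub_pos_of_lt hp
  have hcd := div_le_cdiv (Ap * Bp) (ONE - p) hden
  rw [le_div_iff₀ ONE_facts.1]
  refine le_trans ?_ hcd
  have hdenR : (0 : ℝ) < ((ONE - p : ℕ) : ℝ) := by exact_mod_cast hden
  rw [le_div_iff₀ hdenR]
  have h4 : 0 < 1 - w' := by linarith
  have hO1 := ONE_facts.1
  have hAB : A * B ≤ (Ap : ℝ) / ONE * ((Bp : ℝ) / ONE) := mul_le_mul hA hB hB0 (hA0.trans hA)
  have hE : ((ONE - p : ℕ) : ℝ) ≤ (1 - w') * ONE := by rwa [div_le_iff₀ ONE_facts.1] at hw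
  have hO : (ONE : ℝ) ≠ 0 := ONE_facts.2.1
  have hpos : 0 ≤ A * B * (1 / (1 - w')) * ONE :=
    mul_nonneg (mul_nonneg (mul_nonneg hA0 hB0) (div_nonneg zero_le_one h4.le)) hO1.le
  calc A * B * (1 / (1 - w')) * ONE * ((ONE - p : ℕ) : ℝ)
      ≤ A * B * (1 / (1 - w')) * ONE * ((1 - w') * ONE) := mul_le_mul_of_nonneg_left hE hpos
    _ = (A * B) * ONE * ONE := by field_simp
    _ ≤ ((Ap : ℝ) / ONE * ((Bp : ℝ) / ONE)) * ONE * ONE := by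
        apply mul_le_mul_of_nonneg_right _ hO1.le
        exact mul_le_mul_of_nonneg_right hAB hO1.le
    _ = ((Ap * Bp : ℕ) : ℝ) := by push_cast; field_simp

/-- `(ONE − ypOfT y)/ONE ≤ 1 − (KK+2)/(KK+1)·(y/ONE)` when `ypOfT y < ONE`. -/
theorem one_sub_ratio_ge (y : ℕ) (hyp : ypOfT y < ONE) :
    ((ONE - ypOfT y : ℕ) : ℝ) / ONE ≤ 1 - (((KK : ℝ) + 2) / ((KK : ℝ) + 1)) * ((y : ℝ) / ONE) := by
  have := ratio_le_ypOfT y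
  rw [Nat.cast_sub hyp.le, sub_div, div_self ONE_facts.2.1]
  linarith

/-- The ratio is `< 1` when its fixed point is `< ONE`. -/
theorem ratio_lt_one (y : ℕ) (hyp : ypOfT y < ONE) :
    (((KK : ℝ) + 2) / ((KK : ℝ) + 1)) * ((y : ℝ) / ONE) < 1 := by
  have h1 := ratio_le_ypOfT y
  have : (ypOfT y : ℝ) / ONE < 1 := by rw [div_lt_one ONE_facts.1]; exact_mod_cast hyp
  linarith

/-- **Uniform `k`-tail: `Σ_{i<n, KK≤i} b̃_{i+1} ≤ T/ONE`, `T = TOf D y`, for all `d ≥ D`** (given `ypOfT y < ONE`). -/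
theorem sumTail_le_TOf {D y d : ℕ} (hD : 0 < D) (hy : √8 / (D : ℝ) ≤ (y : ℝ) / ONE) (hd : D ≤ d)
    (hyp : ypOfT y < ONE) (n : ℕ) :
    ∑ i ∈ range n, (if KK ≤ i then bt d (i + 1) else 0) ≤ (TOf D y : ℝ) / ONE := by
  set w : ℝ := (y : ℝ) / ONE with hw_def
  have hw0 : 0 ≤ w := fp_nonneg y
  have hw'1 := ratio_lt_one y hyp
  have hc : (0 : ℝ) ≤ (D : ℝ) / 12 := by positivity
  have ha : ∀ i, KK ≤ i → bt d (i + 1) ≤ (D : ℝ) / 12 * ((i : ℝ) + 1) * w ^ (i - 1) := by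
    intro i hi
    have h := bt_le_unif hD hy hd (by unfold KK at hi; omega : 4 ≤ i + 1)
    have e : i + 1 - 2 = i - 1 := by omega
    rw [e] at h
    push_cast at h
    calc bt d (i + 1) ≤ ((i : ℝ) + 1) / 12 * (D : ℝ) * w ^ (i - 1) := h
      _ = (D : ℝ) / 12 * ((i : ℝ) + 1) * w ^ (i - 1) := by ring
  refine (sum_ktail_le (bt d) hc hw0 hw'1 ha n).trans ?_
  unfold TOf
  have h1 : (D : ℝ) / 12 * ((KK : ℝ) + 1) ≤ (ofRatU (D * (KK + 1)) 12 : ℝ) / ONE := by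
    have := ofRatU_ge (D * (KK + 1)) 12 (by norm_num)
    have e : (D : ℝ) / 12 * ((KK : ℝ) + 1) = ((D * (KK + 1) : ℕ) : ℝ) / ((12 : ℕ) : ℝ) := by
      push_cast; ring
    rw [e]; exact this
  have h2 : w ^ (KK - 1) ≤ (powU y (KK - 1) : ℝ) / ONE := powU_ge hw0 le_rfl _
  have hA0 : 0 ≤ (D : ℝ) / 12 * ((KK : ℝ) + 1) := by positivity
  have key := fp_tail_compare hA0 (pow_nonneg hw0 _) h1 h2 hyp hw'1 (one_sub_ratio_ge y hyp)
  calc (D : ℝ) / 12 * (((KK : ℝ) + 1) * w ^ (KK - 1)) * (1 / (1 - (((KK : ℝ) + 2) / ((KK : ℝ) + 1)) * w))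
      = (D : ℝ) / 12 * ((KK : ℝ) + 1) * w ^ (KK - 1) * (1 / (1 - (((KK : ℝ) + 2) / ((KK : ℝ) + 1)) * w)) := by
        ring
    _ ≤ _ := key

/-- `Σ_{i<n, 2≤i<KK} b̃_{i+1} ≤ B_K⁺/ONE` for any list dominating `b̃` below `KK`. -/
theorem sumBK_le_of {d : ℕ} (bts : List ℕ)
    (hbt : ∀ i, 2 ≤ i → i < KK → bt d (i + 1) ≤ (bts.getD (i - 2) 0 : ℝ) / ONE) (n : ℕ) :
    ∑ i ∈ range n, (if 2 ≤ i ∧ i < KK then bt d (i + 1) else 0) ≤ (BKof bts : ℝ) / ONE := by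
  have key : ∑ i ∈ range n, (if 2 ≤ i ∧ i < KK then bt d (i + 1) else 0)
      ≤ ∑ i ∈ range KK, (if 2 ≤ i ∧ i < KK then bt d (i + 1) else 0) := by
    rcases Nat.lt_or_ge KK n with h | h
    swap
    · exact Finset.sum_le_sum_of_subset_of_nonneg (Finset.range_mono h)
        (fun i _ _ => by split_ifs; exacts [(bt_nonneg d _).1, le_rfl])
    · rw [← Finset.sum_range_add_sum_Ico _ h.le]
      have : ∑ i ∈ Ico KK n, (if 2 ≤ i ∧ i < KK then bt d (i + 1) else 0) = 0 :=
        Finset.sum_eq_zero (fun i hi => by rw [Finset.mem_Ico] at hi; rw [if_neg (by omega)])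
      rw [this, add_zero]
  refine key.trans ?_
  unfold BKof
  rw [Nat.cast_sum, Finset.sum_div]
  apply Finset.sum_le_sum
  intro i hi
  rw [Finset.mem_range] at hi
  by_cases h2 : 2 ≤ i
  · rw [if_pos ⟨h2, hi⟩, if_pos h2]
    exact hbt i h2 hi
  · have hn : ¬ (2 ≤ i ∧ i < KK) := fun h => h2 h.1
    rw [if_neg hn, if_neg h2, Nat.cast_zero, zero_div]

/-- **All partial sums of `b̃` are `≤ 3`** from a head bound `B/ONE`, a tail bound `T/ONE` and `B + T ≤ 3·ONE`. -/
theorem sumB_le_three_of {d B T : ℕ}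
    (hBK : ∀ n, ∑ i ∈ range n, (if 2 ≤ i ∧ i < KK then bt d (i + 1) else 0) ≤ (B : ℝ) / ONE)
    (htail : ∀ n, ∑ i ∈ range n, (if KK ≤ i then bt d (i + 1) else 0) ≤ (T : ℝ) / ONE)
    (hB : B + T ≤ 3 * ONE) (n : ℕ) :
    ∑ i ∈ range n, (if 2 ≤ i then bt d (i + 1) else 0) ≤ 3 := by
  have hsplit : ∀ i ∈ range n, (if 2 ≤ i then bt d (i + 1) else 0)
      = (if 2 ≤ i ∧ i < KK then bt d (i + 1) else 0) + (if KK ≤ i then bt d (i + 1) else 0) := by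
    intro i _
    by_cases h2 : 2 ≤ i
    · by_cases hK : i < KK
      · rw [if_pos h2, if_pos ⟨h2, hK⟩, if_neg (by omega), add_zero]
      · have hn : ¬ (2 ≤ i ∧ i < KK) := fun h => hK h.2
        rw [if_pos h2, if_neg hn, if_pos (by omega), zero_add]
    · have hn : ¬ (2 ≤ i ∧ i < KK) := fun h => h2 h.1
      rw [if_neg h2, if_neg hn, if_neg (by unfold KK; omega), add_zero]
  rw [Finset.sum_congr rfl hsplit, Finset.sum_add_distrib]
  have h1 := hBK n
  have h2 := htail n
  have h3 : ((B : ℝ) + (T : ℝ)) / ONE ≤ 3 := by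
    rw [div_le_iff₀ ONE_facts.1]; exact_mod_cast hB
  rw [add_div] at h3
  linarith

end

end Summit.RiemannHypothesis.RiemannHypothesis.Theorems.JensenPolynomials.CapCert
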